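import Summits.FinalStateConjecture.FinalStateConjecture.Theorems.PhotonSphereChannelsBlindnessWaveTransfer
import Summits.FinalStateConjecture.FinalStateConjecture.Theorems.PhotonSphereChannelsBlindnessWaveCalculus

/-!
# Route PhotonSphereChannels · BlindnessInsidePhotonSphere — bump data, cut-offs and the
# frozen-oscillation ansatz `A(x) cos(ω₀ t)`

Support file (everything proved) for item stmt-FinalStateConjecture-10049. Elementary real
analysis around Mathlib's `Real.smoothTransition`:

* `exists_profile` — a `C²` plateau bump `B` with `B = 0` off `(0, 3)`, `B = 1` on `[1, 2]`,
  `0 ≤ B ≤ 1` and `|B''| ≤ K₂`;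
* `scaled_profile` — the rescaled datum `A(x) = B(c(x − d))`: support, plateau, and
  `A'' = c² B''(c(x − d))`;
* `exists_cutoff` — a non-decreasing `C¹` cut-off equal to `0` on `(−∞, a − η]` and to `1` on
  `(a, ∞)`;
* `ansatz_facts` — for `ψₐ(t, x) = A(x) cos(ω₀ t)`: joint `C²` regularity, the time/space line
  derivatives, and the residual `ψₐ,tt − ψₐ,xx + V ψₐ = ((V − ω₀²) A − A'') cos(ω₀ t)` in the
  `iteratedDeriv` vocabulary of the route statement.

No definitions are introduced.
-/

noncomputable section

open Set Filter Topology Function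

namespace Summit.FinalStateConjecture.FinalStateConjecture.Theorems.Blindness

/-! ### The plateau bump -/

/-- Iterated derivatives of a function vanishing on a neighbourhood vanish. -/
theorem iteratedDeriv_two_eq_zero_of_eventuallyEq {f : ℝ → ℝ} {u : ℝ}
    (h : f =ᶠ[𝓝 u] fun _ => (0 : ℝ)) : iteratedDeriv 2 f u = 0 := by
  have h1 : deriv f =ᶠ[𝓝 u] fun _ => (0 : ℝ) := by
    filter_upwards [h.eventually_nhds] with v hv
    rw [Filter.EventuallyEq.deriv_eq hv, deriv_const]
  rw [iteratedDeriv_succ, iteratedDeriv_one, h1.deriv_eq, deriv_const]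

/-- **A `C²` plateau bump.** There is `B : ℝ → ℝ` of class `C²` with `B(u) = 0` for `u ≤ 0` and
for `u ≥ 3`, `B = 1` on `[1, 2]`, `0 ≤ B ≤ 1`, and `|B''| ≤ K₂` for some `K₂ ≥ 0`
(product of two `Real.smoothTransition`s). -/
theorem exists_profile : ∃ B : ℝ → ℝ, ContDiff ℝ 2 B ∧ (∀ u, u ≤ 0 → B u = 0) ∧
    (∀ u, 3 ≤ u → B u = 0) ∧ (∀ u ∈ Icc (1 : ℝ) 2, B u = 1) ∧ (∀ u, 0 ≤ B u ∧ B u ≤ 1) ∧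
    ∃ K₂ : ℝ, 0 ≤ K₂ ∧ ∀ u, |iteratedDeriv 2 B u| ≤ K₂ := by
  set S := Real.smoothTransition with hS
  set B : ℝ → ℝ := fun u => S u * S (3 - u) with hB
  have hBs : ContDiff ℝ 2 B := by
    have h1 : ContDiff ℝ 2 S := Real.smoothTransition.contDiff
    exact h1.mul (h1.comp (contDiff_const.sub contDiff_id))
  have h0l : ∀ u, u ≤ 0 → B u = 0 := fun u hu => by
    simp [hB, hS, Real.smoothTransition.zero_of_nonpos hu]
  have h0r : ∀ u, 3 ≤ u → B u = 0 := fun u hu => by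
    simp [hB, hS, Real.smoothTransition.zero_of_nonpos (show 3 - u ≤ 0 by linarith)]
  refine ⟨B, hBs, h0l, h0r, fun u hu => ?_, fun u => ?_, ?_⟩
  · simp [hB, hS, Real.smoothTransition.one_of_one_le hu.1,
      Real.smoothTransition.one_of_one_le (show (1 : ℝ) ≤ 3 - u by linarith [hu.2])]
  · exact ⟨mul_nonneg (Real.smoothTransition.nonneg _) (Real.smoothTransition.nonneg _),
      mul_le_one₀ (Real.smoothTransition.le_one _) (Real.smoothTransition.nonneg _)
        (Real.smoothTransition.le_one _)⟩
  · -- `B''` is continuous and vanishes off `[0, 3]`, hence bounded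
    have hc : Continuous (iteratedDeriv 2 B) := hBs.continuous_iteratedDeriv 2 (by norm_num)
    have hz : ∀ u, (u < 0 ∨ 3 < u) → iteratedDeriv 2 B u = 0 := by
      intro u hu
      apply iteratedDeriv_two_eq_zero_of_eventuallyEq
      rcases hu with hu | hu
      · filter_upwards [Iio_mem_nhds hu] with v hv using h0l v (le_of_lt hv)
      · filter_upwards [Ioi_mem_nhds hu] with v hv using h0r v (le_of_lt hv)
    obtain ⟨K, hK⟩ := (isCompact_Icc (a := (0:ℝ)) (b := 3)).exists_bound_of_continuousOn
      hc.continuousOn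
    refine ⟨max K 0, le_max_right _ _, fun u => ?_⟩
    by_cases hu : u ∈ Icc (0 : ℝ) 3
    · exact ((Real.norm_eq_abs _).symm.le.trans (hK u hu)).trans (le_max_left _ _)
    · have hu' : u < 0 ∨ 3 < u := by
        by_contra h
        exact hu ⟨le_of_not_gt fun h' => h (Or.inl h'), le_of_not_gt fun h' => h (Or.inr h')⟩
      rw [hz u hu', abs_zero]; exact le_max_right _ _

/-- **The rescaled datum** `A(x) = B(c (x − d))`, `c > 0`: it is `C²`, vanishes for `x ≤ d` and
for `x ≥ d + 3/c`, equals `1` on `[d + 1/c, d + 2/c]`, takes values in `[0, 1]`, and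
`A''(x) = c² B''(c(x − d))`. -/
theorem scaled_profile {B : ℝ → ℝ} (hB : ContDiff ℝ 2 B) (h0l : ∀ u, u ≤ 0 → B u = 0)
    (h0r : ∀ u, 3 ≤ u → B u = 0) (h1 : ∀ u ∈ Icc (1 : ℝ) 2, B u = 1)
    (h01 : ∀ u, 0 ≤ B u ∧ B u ≤ 1) {c : ℝ} (hc : 0 < c) (d : ℝ) :
    ContDiff ℝ 2 (fun x => B (c * (x - d))) ∧
    (∀ x, x ≤ d → B (c * (x - d)) = 0) ∧ (∀ x, d + 3 / c ≤ x → B (c * (x - d)) = 0) ∧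
    (∀ x ∈ Icc (d + 1 / c) (d + 2 / c), B (c * (x - d)) = 1) ∧
    (∀ x, 0 ≤ B (c * (x - d)) ∧ B (c * (x - d)) ≤ 1) ∧
    (∀ x, iteratedDeriv 2 (fun x => B (c * (x - d))) x = c ^ 2 * iteratedDeriv 2 B (c * (x - d))) := by
  have haff : ContDiff ℝ 2 fun x : ℝ => c * (x - d) := contDiff_const.mul (contDiff_id.sub contDiff_const)
  refine ⟨hB.comp haff, fun x hx => h0l _ ?_, fun x hx => h0r _ ?_, fun x hx => h1 _ ?_,
    fun x => h01 _, fun x => ?_⟩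
  · nlinarith
  · have h3 : 3 / c * c = 3 := div_mul_cancel₀ 3 hc.ne'
    nlinarith
  · constructor
    · have h := hx.1
      have h3 : 1 / c * c = 1 := div_mul_cancel₀ 1 hc.ne'
      nlinarith
    · have h := hx.2
      have h3 : 2 / c * c = 2 := div_mul_cancel₀ 2 hc.ne'
      nlinarith
  · -- two chain rules
    have hl : ∀ y, HasDerivAt (fun x : ℝ => c * (x - d)) c y := fun y => by
      simpa using ((hasDerivAt_id y).sub_const d).const_mul c
    have hB1 : ∀ u, HasDerivAt B (deriv B u) u := fun u =>
      ((hB.differentiable (by norm_num)) u).hasDerivAt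
    have hB' : ContDiff ℝ 1 (deriv B) := by
      have h2 : ContDiff ℝ (1 + 1) B := by simpa [one_add_one_eq_two] using hB
      exact (contDiff_succ_iff_deriv.1 h2).2.2
    have hB2 : ∀ u, HasDerivAt (deriv B) (deriv (deriv B) u) u := fun u =>
      ((hB'.differentiable one_ne_zero) u).hasDerivAt
    have hfirst : ∀ y, HasDerivAt (fun x => B (c * (x - d))) (c * deriv B (c * (y - d))) y := by
      intro y
      have h := (hB1 (c * (y - d))).comp y (hl y)
      exact (h.congr_of_eventuallyEq (Eventually.of_forall fun _ => rfl)).congr_deriv (by ring)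
    have hsecond : HasDerivAt (fun y => c * deriv B (c * (y - d)))
        (c ^ 2 * iteratedDeriv 2 B (c * (x - d))) x := by
      have h := ((hB2 (c * (x - d))).comp x (hl x)).const_mul c
      refine (h.congr_of_eventuallyEq (Eventually.of_forall fun _ => rfl)).congr_deriv ?_
      rw [iteratedDeriv_succ, iteratedDeriv_one]; ring
    exact iteratedDeriv_two_eq_of_hasDerivAt hfirst hsecond

/-! ### The cut-off -/

/-- **A non-decreasing `C¹` cut-off** equal to `0` on `(−∞, a − η]` and to `1` on `[a, ∞)`,
with values in `[0, 1]` (`η > 0`). -/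
theorem exists_cutoff (a : ℝ) {η : ℝ} (hη : 0 < η) : ∃ χ : ℝ → ℝ, ContDiff ℝ 1 χ ∧
    (∀ u, 0 ≤ deriv χ u) ∧ (∀ u, 0 ≤ χ u ∧ χ u ≤ 1) ∧ (∀ u, a < u → χ u = 1) ∧
    (∀ u, u ≤ a - η → χ u = 0) := by
  set S := Real.smoothTransition with hS
  refine ⟨fun u => S ((u - a) / η + 1), ?_, ?_, fun u => ⟨Real.smoothTransition.nonneg _,
    Real.smoothTransition.le_one _⟩, fun u hu => ?_, fun u hu => ?_⟩
  · exact Real.smoothTransition.contDiff.comp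
      (((contDiff_id.sub contDiff_const).div_const η).add contDiff_const)
  · intro u
    have hmono : Monotone fun u => S ((u - a) / η + 1) := by
      intro u v huv
      apply Real.smoothTransition.monotone
      have : (u - a) / η ≤ (v - a) / η := div_le_div_of_nonneg_right (by linarith) hη.le
      linarith
    exact hmono.deriv_nonneg
  · apply Real.smoothTransition.one_of_one_le
    have : 0 ≤ (u - a) / η := div_nonneg (by linarith) hη.le
    linarith
  · apply Real.smoothTransition.zero_of_nonpos
    have : (u - a) / η ≤ -1 := by
      rw [div_le_iff₀ hη]; linarith
    linarith

/-! ### The frozen-oscillation ansatz `ψₐ(t, x) = A(x) cos(ω₀ t)` -/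

/-- **Facts on the ansatz.** For `A ∈ C²` and a frequency `ω₀`, the field
`ψₐ(t, x) = A(x) cos(ω₀ t)` is jointly `C²`, `ψₐ(0, ·) = A`, `∂_t ψₐ(0, ·) = 0`, its lines have
the expected first derivatives, and its residual in the route statement's vocabulary is
`ψₐ,tt − ψₐ,xx + Vψₐ = ((V − ω₀²) A − A'') cos(ω₀ t)`. -/
theorem ansatz_facts {A : ℝ → ℝ} (hA : ContDiff ℝ 2 A) (ω₀ : ℝ) (V : ℝ → ℝ) :
    ContDiff ℝ 2 (uncurry fun t x => A x * Real.cos (ω₀ * t)) ∧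
    (∀ t x, HasDerivAt (fun τ => A x * Real.cos (ω₀ * τ)) (-(A x * ω₀ * Real.sin (ω₀ * t))) t) ∧
    (∀ t x, HasDerivAt (fun y => A y * Real.cos (ω₀ * t)) (deriv A x * Real.cos (ω₀ * t)) x) ∧
    (∀ t x, iteratedDeriv 2 (fun τ => A x * Real.cos (ω₀ * τ)) t
        - iteratedDeriv 2 (fun y => A y * Real.cos (ω₀ * t)) x + V x * (A x * Real.cos (ω₀ * t))
      = ((V x - ω₀ ^ 2) * A x - iteratedDeriv 2 A x) * Real.cos (ω₀ * t)) := by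
  have hcos : ∀ t, HasDerivAt (fun τ => Real.cos (ω₀ * τ)) (-(ω₀ * Real.sin (ω₀ * t))) t := by
    intro t
    have h := (Real.hasDerivAt_cos (ω₀ * t)).comp t ((hasDerivAt_id t).const_mul ω₀)
    exact (h.congr_of_eventuallyEq (Eventually.of_forall fun _ => rfl)).congr_deriv
      (by simp; ring)
  have hsin : ∀ t, HasDerivAt (fun τ => Real.sin (ω₀ * τ)) (ω₀ * Real.cos (ω₀ * t)) t := by
    intro t
    have h := (Real.hasDerivAt_sin (ω₀ * t)).comp t ((hasDerivAt_id t).const_mul ω₀)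
    exact (h.congr_of_eventuallyEq (Eventually.of_forall fun _ => rfl)).congr_deriv
      (by simp; ring)
  have hA1 : ∀ x, HasDerivAt A (deriv A x) x := fun x => ((hA.differentiable (by norm_num)) x).hasDerivAt
  have hA' : ContDiff ℝ 1 (deriv A) := by
    have h2 : ContDiff ℝ (1 + 1) A := by simpa [one_add_one_eq_two] using hA
    exact (contDiff_succ_iff_deriv.1 h2).2.2
  have hA2 : ∀ x, HasDerivAt (deriv A) (iteratedDeriv 2 A x) x := fun x => by
    rw [iteratedDeriv_succ, iteratedDeriv_one]
    exact ((hA'.differentiable one_ne_zero) x).hasDerivAt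
  -- time lines
  have ht1 : ∀ t x, HasDerivAt (fun τ => A x * Real.cos (ω₀ * τ)) (-(A x * ω₀ * Real.sin (ω₀ * t))) t :=
    fun t x => ((hcos t).const_mul (A x)).congr_deriv (by ring)
  have ht2 : ∀ t x, HasDerivAt (fun τ => -(A x * ω₀ * Real.sin (ω₀ * τ)))
      (-(A x * ω₀ ^ 2 * Real.cos (ω₀ * t))) t := fun t x =>
    (((hsin t).const_mul (A x * ω₀)).neg).congr_deriv (by ring)
  -- space lines
  have hx1 : ∀ t x, HasDerivAt (fun y => A y * Real.cos (ω₀ * t)) (deriv A x * Real.cos (ω₀ * t)) x :=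
    fun t x => (hA1 x).mul_const _
  have hx2 : ∀ t x, HasDerivAt (fun y => deriv A y * Real.cos (ω₀ * t))
      (iteratedDeriv 2 A x * Real.cos (ω₀ * t)) x := fun t x => (hA2 x).mul_const _
  refine ⟨?_, ht1, hx1, fun t x => ?_⟩
  · exact (hA.comp contDiff_snd).mul (Real.contDiff_cos.comp (contDiff_const.mul contDiff_fst))
  · rw [iteratedDeriv_two_eq_of_hasDerivAt (fun τ => ht1 τ x) (ht2 t x),
      iteratedDeriv_two_eq_of_hasDerivAt (fun y => hx1 t y) (hx2 t x)]
    ring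

end Summit.FinalStateConjecture.FinalStateConjecture.Theorems.Blindness

end
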